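import Summits.BirchSwinnertonDyer.BirchSwinnertonDyer.Theorems.ByReductionTypeAtTwoMultUpperHalfKatoIntSplit
import Summits.BirchSwinnertonDyer.Rank1Residual.X5.TwoAdicTargetsSplitKappaCert
import HarnessLib

/-!
# `MultUpperHalfAtTwo` (item 19922), road (vi) — SPLIT multiplicative `2`, slack one + parity — ON THE κ₁-VALUATION
# CERTIFICATE: the GS-free twin of `missingUpperBoundAt_two_split_of_katoUpToOne_of_even`

Cell `bsd-2adic` (run/shared/lean/pub/bsd-2adic/), seat `bsd-2adic-mult` GEN 8. HONEST FRAMING: research route; nothing is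
asserted; no class is closed here; no count moves. ONE theorem: mult-2's road-(vi) door (p-file
`ByReductionTypeAtTwoMultUpperHalfKatoIntSplit.lean`, the `Δ > 0` parity road of the 127 PAR-SP classes) with the named fact
`greenberg_stevens W 2` (blocker B-ii: printed only for odd `p`) REPLACED by the per-class certificate
`hκ : O1.AnalyticKappaOneValuationAtTwo W` (`X5/TwoAdicTargetsSplitKappaCert.lean`, p451828): the original consumes `hGS` only
through `O1.kappaOne_of_greenbergStevens`, whose conclusion `O1.kappaOne_of_kappaCert` supplies from `hκ`. In analytic rank `0`
`hGS ⇒ hκ` (`O1.analyticKappaOneValuationAtTwo_of_greenbergStevens`), so nothing is weaker. Certificates: HOME/mult/CERT-KAPPA1.md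
(93/127 PAR-SP classes certified at v1, identity verified on all of them).
PARTITION (D-0054): X5@2 mult, SPLIT, E[2]-irreducible, `Δ > 0` (127 PAR-SP classes) × p = 2 — types-the-object-of; closes none.
References: [GreenbergLNM1716] §4 pp. 112–113; [MazurTateTeitelbaum1986Invent] §I.14–15, §II; [SilvermanAEC2009] X.4.14;
[Cesnavicius2018] Thm. 1.2; [Miller2011LMS] Def. 1.1.
-/

set_option autoImplicit false
set_option linter.dupNamespace false

noncomputable section

open scoped Classical MatrixGroups ModularForm

open CongruenceSubgroup WeierstrassCurve Literature.NumberTheory.EllipticCurves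
  Literature.NumberTheory.EllipticCurves.ModularForms
  Literature.NumberTheory.EllipticCurves.Greenberg1999
  Literature.NumberTheory.EllipticCurves.Rank1Residual
  Literature.NumberTheory.EllipticCurves.Rank1Residual.Typed
  Literature.NumberTheory.Transcendental
  Summit.BirchSwinnertonDyer.Rank1Residual.X5

namespace Summit.BirchSwinnertonDyer.BirchSwinnertonDyer.Theorems

/-- `ord_p #Ш` is even for finite `Ш` (Cassels–Tate). Private twin of the p-file's lemma. [cite: SilvermanAEC2009, Thm. X.4.14] -/
private theorem even_padicValNat_shaOrder_cert
    (hCT : WeierstrassCurve.exists_casselsTate_pairing (K := ℚ)) (W : WeierstrassCurve ℚ) [W.IsElliptic]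
    (hfin : Finite W.sha) (p : ℕ) [Fact p.Prime] : Even (padicValNat p W.shaOrder) := by
  have hfin' : W.ShaFinite := hfin
  obtain ⟨r, hr⟩ := WeierstrassCurve.isSquare_shaOrder_of_casselsTate hCT W hfin'
  have hpos : 0 < W.shaOrder := W.shaOrder_pos hfin'
  have hr0 : r ≠ 0 := by
    rintro rfl
    rw [hr, mul_zero] at hpos
    exact lt_irrefl 0 hpos
  exact ⟨padicValNat p r, by rw [hr, padicValNat.mul hr0 hr0]⟩

/-- **ROAD (vi) per member ON THE CERTIFICATE — split multiplicative `2`, slack ONE + parity, no `greenberg_stevens`.**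
Verbatim `missingUpperBoundAt_two_split_of_katoUpToOne_of_even` with `hGS` replaced by `hκ : O1.AnalyticKappaOneValuationAtTwo W`:
the slack-one Kato datum `hK1sp` (MEMO PROOF-KATO2SPLIT Thm. B, `Δ > 0` face), A236 (`h41sp`), modularity, GZK, Česnavičius (`hC`),
Cassels–Tate (`hCT`), the CERTIFICATE «`#Ш_an(W) = q`, `ord₂ q` even» and the κ₁-certificate ⟹ `MissingUpperBoundAt W 2`.
[cite: GreenbergLNM1716, §4 pp. 112–113 (split l_v)] [cite: MazurTateTeitelbaum1986Invent, §I.14–15 and §II]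
[cite: SilvermanAEC2009, Thm. X.4.14] [cite: Cesnavicius2018, Thm. 1.2] [cite: Miller2011LMS, Def. 1.1] -/
theorem missingUpperBoundAt_two_split_of_katoUpToOne_of_even_of_kappaCert (W : WeierstrassCurve ℚ) [W.IsElliptic]
    [W.IsGloballyMinimal] (h41sp : thm41Analogue_charValue_rankZero_split_baseChange_anyPrime)
    (hκ : O1.AnalyticKappaOneValuationAtTwo W)
    (hmod : nonempty_modularParametrizationData) (hGZK : rank_eq_analyticRank_of_analyticRank_le_one)
    (hCT : WeierstrassCurve.exists_casselsTate_pairing (K := ℚ))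
    (hC : cesnavicius_not_two_dvd_maninConstant_of_two_dvd_level)
    (hK1sp : ∀ (κ : ZpExtension ℚ 2) (γ : Field.absoluteGaloisGroup ℚ), κ.IsCyclotomic → κ.IsTopGenerator γ →
      IsCyclotomicVariable 2 γ →
      ∀ [NeZero (W.conductorNorm ℤ)] (f : CuspForm (Gamma0 (W.conductorNorm ℤ)) 2), IsNewformOf W f →
      ∀ ϖ : ℚ, (ϖ : ℝ) * W.realPeriodRat = plusPeriod f →
      ∀ L : PowerSeries ℚ_[2], IsSplitMultPAdicLFunctionOf f 2 L → ∀ D : W.SelmerDualData κ γ,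
        D.IsTorsion ∧ ∃ g ∈ D.charIdeal,
          iwasawaToPowerSeries 2 (PowerSeries.X * g) = PowerSeries.C ((2 * ϖ : ℚ) : ℚ_[2]) * L)
    (hr : W.analyticRank = 0) (hmult : Mult W 2) (hsp : W.HasSplitMultiplicativeReductionAtPrime 2)
    (him : O1.TwoAdicSurjective W) (heven : ∃ q : ℚ, shaAn W = (q : ℂ) ∧ Even (padicValRat 2 q)) :
    MissingUpperBoundAt W 2 := by
  haveI : NeZero (W.conductorNorm ℤ) := ⟨(W.conductorNorm_pos_holds).ne'⟩
  obtain ⟨Dm⟩ := hmod W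
  have hf : IsNewformOf W Dm.f := Dm.isNewformOf
  have hL : W.entireLFunction 1 ≠ 0 :=
    (W.analyticRank_eq_zero_iff_holds hf.hasEntireLFunction).mp hr
  obtain ⟨ϖ, hϖpos, hϖeq, -⟩ := Dm.exists_rat_mul_realPeriodRat_eq_plusPeriod
  obtain ⟨κ, hκ', γ, hγ, hγ'⟩ := exists_isCyclotomic_isTopGenerator_isCyclotomicVariable_holds 2
  obtain ⟨D⟩ := W.nonempty_selmerDualData_holds κ γ hγ
  obtain ⟨L, hLf⟩ := exists_isSplitMultPAdicLFunctionOf hsp hf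
  obtain ⟨Dq⟩ := (nonempty_tateParameterData_iff_holds (W := W) (p := 2)).mpr hsp
  have hlog : padicLog 2 Dq.q ≠ 0 := Dq.padicLog_q_ne_zero MahlerManinPadic_holds
  have hper : padicValRat 2 ϖ = 0 := padicValRat_periodRatio_eq_zero_of_irr_two hC W hmult
    (O1.irr_two_of_twoAdicSurjective W him) Dm.f hf ϖ hϖeq
  have hϖ0 : ϖ ≠ 0 := hϖpos.ne'
  have h2ϖ0 : (2 * ϖ : ℚ) ≠ 0 := mul_ne_zero two_ne_zero hϖ0
  have h22 : padicValRat 2 (2 : ℚ) = 1 := by exact_mod_cast padicValRat.self (p := 2) one_lt_two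
  have hk : padicValRat 2 (2 * ϖ) ≤ padicValRat 2 ϖ + (1 : ℕ) := by
    rw [padicValRat.mul two_ne_zero hϖ0, h22]
    push_cast
    linarith
  have hdiv := hK1sp κ γ hκ' hγ hγ' Dm.f hf ϖ hϖeq L hLf D
  obtain ⟨q, hq, hle⟩ := O1.upperBound_two_split_of_divisibilityRat W
    (O1.twoAdicEulerCharRankZeroSplitMult_zero_of_greenberg W h41sp) hGZK hmult hsp hL hκ' hγ hγ' hf Dq hlog
    (O1.kappaOne_of_kappaCert W hκ hf hLf Dq) D ϖ hϖeq h2ϖ0 1 hk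
    (by simpa only [Rat.cast_mul, Rat.cast_ofNat] using hdiv)
  have hle' : (padicValNat 2 W.shaOrder : ℤ) ≤ padicValRat 2 q + 1 := by simpa using hle
  have hfin : Finite W.sha := (hGZK W (by rw [hr]; exact zero_le_one)).2
  have hevenSha : Even ((padicValNat 2 W.shaOrder : ℕ) : ℤ) :=
    (even_padicValNat_shaOrder_cert hCT W hfin 2).natCast
  obtain ⟨u, hu⟩ := hevenSha
  obtain ⟨q', hq', v, hv⟩ := heven
  have hqq : q' = q := by exact_mod_cast hq'.symm.trans hq
  subst hqq
  exact ⟨q', hq, by omega⟩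

end Summit.BirchSwinnertonDyer.BirchSwinnertonDyer.Theorems

end
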